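import Summits.QuantumFields.YangMills.Theorems.UnitScaleTiltProp7CovariantTransport
import Summits.QuantumFields.YangMills.Theorems.UnitScaleTiltProp7LineAvgTaylor
import HarnessLib

/-!
# Route `UnitScaleTilt`, crux K1 child «MinimiserStabilityRegPr» (stmt-QuantumFields-19200), registered stub `stub_prop7From14` (leaf V3 «Prop 7 from a
# background (14)») — THE COVARIANT STRAIGHT-LINE BLOCK AVERAGE AT AN ARBITRARY UNITARY BACKGROUND, TO SECOND ORDER IN `ℓ²`-ALONG-CONTOURS FORM:
# `U([x, x+ne_μ])·U₀([x, x+ne_μ])⁻¹ = Π_{t<n}(1 + R(U₀([x, x+te_μ]))Y(x+te_μ))` exactly, and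
# `‖L^{−kd}Σ_r R(comb_r)(U(line_r)U₀(line_r)⁻¹ − 1) − L^k·(M_{U₀}Y)(c)‖ ≤ L^{−k(d−1)}Σ_rΣ_t‖Y(x_r+te_μ)‖²`

Cell `ym3-torus` ∕ fleet seat `ym-ust-19200-p1` (gen 4).  WHERE THIS SITS.  The item's small-field engine off the kernel
(`Prop7CovariantCoercivity.sum_normSq_le_curl_sq_add_divB_sq_add_avg_T3`, p483802) keeps the averaging penalty `16·L^{k(d−2)}·Σ_c‖(M_{U₀}Y)(c)‖²` with the
COVARIANT straight-line block average `(M_{U₀}Y)(c) = (L^{kd}L^k)⁻¹Σ_rΣ_t R(U₀(Γ_{ȳ,x_r})U₀([x_r, x_r+te_μ]))Y(x_r+te_μ)` (comb transport to the block base point,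
then along the contour).  For a fluctuation `Y = UU₀⁻¹ − 1` between two configurations whose block averages of the straight contours agree (the model constraint),
`M_{U₀}Y` is minus the second-order remainder of the contour products; the `ℓ²` uniqueness route (p504929) can absorb that penalty only if the remainder is
quadratic in the `ℓ²` mass of `Y` along the contours (CARD-19200-V3-g4, D1c (iii)).  The flat model is `UnitScaleTiltProp7LineAvgTaylor` (this seat);
here the SAME bound at an ARBITRARY unitary background, with no smallness of `U₀` whatsoever: conjugation by the background transports is an isometry.

WHAT IS PROVED HERE (sorry-free, no definition; [folklore] algebra + the product estimates of `Prop7LineAvgTaylor`).  `U = (1+Y)U₀` bondwise, `U₀` with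
values in `U1` (norm ≤ 1 units with norm ≤ 1 inverses), `R(u)X = uXu⁻¹`.
* §1 **`holT_line_eq_prod_mul`** (EXACT FACTORISATION): `U([x, x+ne_μ]) = [Π_{t<n}(1 + R(U₀([x, x+te_μ]))Y(x+te_μ))]·U₀([x, x+ne_μ])` (ordered product);
  `holT_line_mul_inv_eq_prod`.
* §2 **`norm_lineRatio_sub_one_sub_sum_le`**: `‖U(line)U₀(line)⁻¹ − 1 − Σ_{t<n}R(U₀([x,x+te_μ]))Y(x+te_μ)‖ ≤ n·Σ_{t<n}‖Y(x+te_μ)‖²` for `‖Y‖ ≤ δ`, `nδ ≤ 1`.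
* §3 **`norm_avg_lineRatio_sub_smul_covLineAvg_le`**: the displayed block inequality, the covariant average written exactly as in p483802 (`conjR (holT U₀ ȳ
  (treeWord r) * holT U₀ x_r (replicate t)) (Y …)`), for every unitary background — `k`-uniform, volume-free, background-free constants.

WHAT THIS IS NOT.  The (0.4) average of record has comb-decorated contours and an `exp`-mean-`log` projection (`BlockAveraging.avgFun`); its linearisation at a
background is `BlockAveragingEMLLinearisedBackground` (p484812, SUP remainder `404ℓδ(ℓδ+α)`).  The `ℓ²`-along-contours remainder for it remains open.  Nothing
of Bałaban's is asserted.

References: T. Bałaban, CMP 102 (1985) 277–309 [Balaban1985Variational] ((44) p.285, (152) p.300); CMP 98 (1985) 17–51 [Balaban1985Averaging] (Prop. 3 (122)–(125) p.36).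
-/

noncomputable section

open scoped BigOperators Matrix.Norms.L2Operator

namespace Summit.QuantumFields.YangMills.Theorems.Prop7CovLineAvgTaylor

open Literature.MathematicalPhysics.QuantumFieldTheory.Balaban1983to89
open Finset B1RG242Torus
open B7Prop1Explicit (Letter treeWord U1)
open B7Eq78Linearization (conjR conjR_apply conjR_sub conjR_add)
open B8Ineq132 (norm_conjR conjR_conjR one_conjR)
open B10Eq27TorusAxialLog (holT holT_append holT_nil)
open Summit.QuantumFields.YangMills.Theorems.Prop7CovariantCoercivity (holT_mem holT_replicate_succ)
open Summit.QuantumFields.YangMills.Theorems.Prop7LineAvgTaylor (norm_prod_ofFn_sub_one_sub_sum_le_mul_sum_sq)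

variable {N : ℕ} [NeZero N]
variable {P : Params} {i : ℕ}


/-! ## §1 The exact factorisation of a perturbed straight contour -/

section Factorisation

omit [NeZero N] in
/-- `R(u)` is additive over finite sums. [folklore] -/
theorem conjR_sum {ι : Type*} (u : (Matrix (Fin N) (Fin N) ℂ)ˣ) (s : Finset ι) (f : ι → Matrix (Fin N) (Fin N) ℂ) : conjR u (∑ j ∈ s, f j) = ∑ j ∈ s, conjR u (f j) := by
  simp only [conjR_apply, Finset.mul_sum, Finset.sum_mul]

variable (V V₀ : GaugeField P i (Matrix (Fin N) (Fin N) ℂ)ˣ) (Y : PBond P i → Matrix (Fin N) (Fin N) ℂ) (hY : ∀ b : PBond P i, (V b : Matrix (Fin N) (Fin N) ℂ) = (1 + Y b) * (V₀ b : Matrix (Fin N) (Fin N) ℂ))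
include hY

omit [NeZero N] in
/-- **EXACT FACTORISATION OF A PERTURBED STRAIGHT CONTOUR**: for `U = (1+Y)U₀` bondwise,
`U([x, x+ne_μ]) = [Π_{t<n}(1 + R(U₀([x, x+te_μ]))Y(x+te_μ))]·U₀([x, x+ne_μ])` (ordered product over `t = 0,…,n−1`). [folklore] -/
theorem holT_line_eq_prod_mul (x : Site P i) (μ : Fin P.d) (n : ℕ) :
    ((holT V x (List.replicate n (μ, true)) : (Matrix (Fin N) (Fin N) ℂ)ˣ) : Matrix (Fin N) (Fin N) ℂ)
      = (List.ofFn fun t : Fin n => 1 + conjR (holT V₀ x (List.replicate (t : ℕ) (μ, true))) (Y ⟨(fun z : Site P i => z.shift μ)^[(t : ℕ)] x, μ⟩)).prod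
        * ((holT V₀ x (List.replicate n (μ, true)) : (Matrix (Fin N) (Fin N) ℂ)ˣ) : Matrix (Fin N) (Fin N) ℂ) := by
  induction n with
  | zero => simp
  | succ n ih =>
    rw [holT_replicate_succ V x μ n, holT_replicate_succ V₀ x μ n, Units.val_mul, Units.val_mul, ih, List.ofFn_succ', List.prod_concat]
    simp only [Fin.val_castSucc, Fin.val_last]
    set Pr := (List.ofFn fun t : Fin n => 1 + conjR (holT V₀ x (List.replicate (t : ℕ) (μ, true))) (Y ⟨(fun z : Site P i => z.shift μ)^[(t : ℕ)] x, μ⟩)).prod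
    set H₀ : (Matrix (Fin N) (Fin N) ℂ)ˣ := holT V₀ x (List.replicate n (μ, true))
    rw [hY, conjR_apply]
    -- `Pr·H₀·((1+Y)V₀) = Pr·(1 + H₀YH₀⁻¹)·(H₀V₀)`
    have hinv : ((H₀⁻¹ : (Matrix (Fin N) (Fin N) ℂ)ˣ) : Matrix (Fin N) (Fin N) ℂ) * (H₀ : Matrix (Fin N) (Fin N) ℂ) = 1 := by
      rw [← Units.val_mul, inv_mul_cancel, Units.val_one]
    calc Pr * (H₀ : Matrix (Fin N) (Fin N) ℂ) * ((1 + Y ⟨(fun z : Site P i => z.shift μ)^[n] x, μ⟩) * (V₀ ⟨(fun z : Site P i => z.shift μ)^[n] x, μ⟩ : Matrix (Fin N) (Fin N) ℂ))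
        = Pr * ((H₀ : Matrix (Fin N) (Fin N) ℂ) + (H₀ : Matrix (Fin N) (Fin N) ℂ) * Y ⟨(fun z : Site P i => z.shift μ)^[n] x, μ⟩
              * (((H₀⁻¹ : (Matrix (Fin N) (Fin N) ℂ)ˣ) : Matrix (Fin N) (Fin N) ℂ) * (H₀ : Matrix (Fin N) (Fin N) ℂ)))
            * (V₀ ⟨(fun z : Site P i => z.shift μ)^[n] x, μ⟩ : Matrix (Fin N) (Fin N) ℂ) := by rw [hinv]; noncomm_ring
      _ = Pr * (1 + (H₀ : Matrix (Fin N) (Fin N) ℂ) * Y ⟨(fun z : Site P i => z.shift μ)^[n] x, μ⟩ * ((H₀⁻¹ : (Matrix (Fin N) (Fin N) ℂ)ˣ) : Matrix (Fin N) (Fin N) ℂ))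
            * ((H₀ : Matrix (Fin N) (Fin N) ℂ) * (V₀ ⟨(fun z : Site P i => z.shift μ)^[n] x, μ⟩ : Matrix (Fin N) (Fin N) ℂ)) := by noncomm_ring

omit [NeZero N] in
/-- The ratio form: `U([x, x+ne_μ])·U₀([x, x+ne_μ])⁻¹ = Π_{t<n}(1 + R(U₀([x, x+te_μ]))Y(x+te_μ))`. [folklore] -/
theorem holT_line_mul_inv_eq_prod (x : Site P i) (μ : Fin P.d) (n : ℕ) :
    ((holT V x (List.replicate n (μ, true)) : (Matrix (Fin N) (Fin N) ℂ)ˣ) : Matrix (Fin N) (Fin N) ℂ) * (((holT V₀ x (List.replicate n (μ, true)))⁻¹ : (Matrix (Fin N) (Fin N) ℂ)ˣ) : Matrix (Fin N) (Fin N) ℂ)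
      = (List.ofFn fun t : Fin n => 1 + conjR (holT V₀ x (List.replicate (t : ℕ) (μ, true))) (Y ⟨(fun z : Site P i => z.shift μ)^[(t : ℕ)] x, μ⟩)).prod := by
  rw [holT_line_eq_prod_mul V V₀ Y hY x μ n, mul_assoc, ← Units.val_mul, mul_inv_cancel, Units.val_one, mul_one]

end Factorisation

/-! ## §2 The second-order remainder along one contour -/

section Line

variable {V V₀ : GaugeField P i (Matrix (Fin N) (Fin N) ℂ)ˣ} {Y : PBond P i → Matrix (Fin N) (Fin N) ℂ} (hY : ∀ b : PBond P i, (V b : Matrix (Fin N) (Fin N) ℂ) = (1 + Y b) * (V₀ b : Matrix (Fin N) (Fin N) ℂ))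
  (hV₀ : ∀ b : PBond P i, V₀ b ∈ U1 (Matrix (Fin N) (Fin N) ℂ)) {δ : ℝ} (hYδ : ∀ b : PBond P i, ‖Y b‖ ≤ δ)
include hY hV₀ hYδ

/-- **SECOND-ORDER REMAINDER ALONG ONE CONTOUR, ANY UNITARY BACKGROUND**: for `‖Y‖ ≤ δ` with `nδ ≤ 1`,
`‖U(line)U₀(line)⁻¹ − 1 − Σ_{t<n}R(U₀([x,x+te_μ]))Y(x+te_μ)‖ ≤ n·Σ_{t<n}‖Y(x+te_μ)‖²` (the transports are isometries). [cite: Balaban1985Averaging, Prop. 3 (122)-(125) p.36] -/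
theorem norm_lineRatio_sub_one_sub_sum_le {n : ℕ} (hnδ : (n : ℝ) * δ ≤ 1) (x : Site P i) (μ : Fin P.d) :
    ‖((holT V x (List.replicate n (μ, true)) : (Matrix (Fin N) (Fin N) ℂ)ˣ) : Matrix (Fin N) (Fin N) ℂ) * (((holT V₀ x (List.replicate n (μ, true)))⁻¹ : (Matrix (Fin N) (Fin N) ℂ)ˣ) : Matrix (Fin N) (Fin N) ℂ) - 1
        - ∑ t : Fin n, conjR (holT V₀ x (List.replicate (t : ℕ) (μ, true))) (Y ⟨(fun z : Site P i => z.shift μ)^[(t : ℕ)] x, μ⟩)‖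
      ≤ (n : ℝ) * ∑ t : Fin n, ‖Y ⟨(fun z : Site P i => z.shift μ)^[(t : ℕ)] x, μ⟩‖ ^ 2 := by
  rw [holT_line_mul_inv_eq_prod V V₀ Y hY x μ n]
  have hiso : ∀ t : Fin n, ‖conjR (holT V₀ x (List.replicate (t : ℕ) (μ, true))) (Y ⟨(fun z : Site P i => z.shift μ)^[(t : ℕ)] x, μ⟩)‖
      = ‖Y ⟨(fun z : Site P i => z.shift μ)^[(t : ℕ)] x, μ⟩‖ := fun t => norm_conjR (holT_mem hV₀ x _) _
  have hs : ∑ t : Fin n, ‖conjR (holT V₀ x (List.replicate (t : ℕ) (μ, true))) (Y ⟨(fun z : Site P i => z.shift μ)^[(t : ℕ)] x, μ⟩)‖ ≤ 1 := by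
    simp only [hiso]
    calc ∑ t : Fin n, ‖Y ⟨(fun z : Site P i => z.shift μ)^[(t : ℕ)] x, μ⟩‖ ≤ ∑ _t : Fin n, δ := Finset.sum_le_sum fun t _ => hYδ _
      _ = (n : ℝ) * δ := by rw [Finset.sum_const, Finset.card_univ, Fintype.card_fin, nsmul_eq_mul]
      _ ≤ 1 := hnδ
  have h := norm_prod_ofFn_sub_one_sub_sum_le_mul_sum_sq
    (fun t : Fin n => conjR (holT V₀ x (List.replicate (t : ℕ) (μ, true))) (Y ⟨(fun z : Site P i => z.shift μ)^[(t : ℕ)] x, μ⟩)) hs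
  simp only [hiso] at h
  exact h

end Line

/-! ## §3 The covariant straight-line block average to second order, in `ℓ²`-along-contours form -/

section Block

variable {k : ℕ}
variable {V V₀ : GaugeField P 0 (Matrix (Fin N) (Fin N) ℂ)ˣ} {Y : PBond P 0 → Matrix (Fin N) (Fin N) ℂ} (hY : ∀ b : PBond P 0, (V b : Matrix (Fin N) (Fin N) ℂ) = (1 + Y b) * (V₀ b : Matrix (Fin N) (Fin N) ℂ))
  (hV₀ : ∀ b : PBond P 0, V₀ b ∈ U1 (Matrix (Fin N) (Fin N) ℂ)) {δ : ℝ} (hYδ : ∀ b : PBond P 0, ‖Y b‖ ≤ δ) (hδ : (P.L : ℝ) ^ k * δ ≤ 1)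
include hY hV₀ hYδ hδ

/-- **THE COVARIANT STRAIGHT-LINE BLOCK AVERAGE TO SECOND ORDER, ANY UNITARY BACKGROUND**: with the comb transports `u_r = U₀(Γ_{ȳ, x_r})` to the block base
point `ȳ` (any family of `U1`-valued transports indexed by the offsets will do) and `‖Y‖ ≤ δ`, `L^kδ ≤ 1`:
`‖L^{−kd}Σ_r R(u_r)(U(line_r)U₀(line_r)⁻¹ − 1) − L^{−kd}Σ_rΣ_{t<L^k} R(u_r·U₀([x_r, x_r+te_μ]))Y(x_r+te_μ)‖ ≤ L^{−k(d−1)}·Σ_rΣ_{t<L^k}‖Y(x_r+te_μ)‖²` —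
the subtracted term is `L^k·(M_{U₀}Y)(c)` with the covariant average of p483802 (`(L^{kd}L^k)⁻¹ΣΣ R(…)Y`). [cite: Balaban1985Averaging, Prop. 3 (122)-(125) p.36] -/
theorem norm_avg_lineRatio_sub_smul_covLineAvg_le (μ : Fin P.d) (u : (Fin P.d → Fin (P.L ^ k)) → (Matrix (Fin N) (Fin N) ℂ)ˣ) (hu : ∀ r, u r ∈ U1 (Matrix (Fin N) (Fin N) ℂ))
    (xr : (Fin P.d → Fin (P.L ^ k)) → Site P 0) :
    ‖(((P.L : ℝ) ^ k) ^ P.d)⁻¹ • ∑ r : Fin P.d → Fin (P.L ^ k),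
          conjR (u r) (((holT V (xr r) (List.replicate (P.L ^ k) (μ, true)) : (Matrix (Fin N) (Fin N) ℂ)ˣ) : Matrix (Fin N) (Fin N) ℂ) * (((holT V₀ (xr r) (List.replicate (P.L ^ k) (μ, true)))⁻¹ : (Matrix (Fin N) (Fin N) ℂ)ˣ) : Matrix (Fin N) (Fin N) ℂ) - 1)
        - (((P.L : ℝ) ^ k) ^ P.d)⁻¹ • ∑ r : Fin P.d → Fin (P.L ^ k), ∑ t : Fin (P.L ^ k),
          conjR (u r * holT V₀ (xr r) (List.replicate (t : ℕ) (μ, true))) (Y ⟨(fun z : Site P 0 => z.shift μ)^[(t : ℕ)] (xr r), μ⟩)‖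
      ≤ (((P.L : ℝ) ^ k) ^ (P.d - 1))⁻¹ * ∑ r : Fin P.d → Fin (P.L ^ k), ∑ t : Fin (P.L ^ k), ‖Y ⟨(fun z : Site P 0 => z.shift μ)^[(t : ℕ)] (xr r), μ⟩‖ ^ 2 := by
  have hN : (0 : ℝ) < (P.L : ℝ) ^ k := pow_pos (by exact_mod_cast P.L_pos) k
  have hd : 1 ≤ P.d := P.hd
  have hnδ : ((P.L ^ k : ℕ) : ℝ) * δ ≤ 1 := by push_cast; exact hδ
  rw [← smul_sub, ← Finset.sum_sub_distrib, norm_smul, norm_inv, norm_pow, norm_pow, Real.norm_natCast]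
  -- per offset: pull the comb transport out, it is an isometry
  have hpt : ∀ r : Fin P.d → Fin (P.L ^ k),
      ‖conjR (u r) (((holT V (xr r) (List.replicate (P.L ^ k) (μ, true)) : (Matrix (Fin N) (Fin N) ℂ)ˣ) : Matrix (Fin N) (Fin N) ℂ) * (((holT V₀ (xr r) (List.replicate (P.L ^ k) (μ, true)))⁻¹ : (Matrix (Fin N) (Fin N) ℂ)ˣ) : Matrix (Fin N) (Fin N) ℂ) - 1)
          - ∑ t : Fin (P.L ^ k), conjR (u r * holT V₀ (xr r) (List.replicate (t : ℕ) (μ, true))) (Y ⟨(fun z : Site P 0 => z.shift μ)^[(t : ℕ)] (xr r), μ⟩)‖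
        ≤ ((P.L ^ k : ℕ) : ℝ) * ∑ t : Fin (P.L ^ k), ‖Y ⟨(fun z : Site P 0 => z.shift μ)^[(t : ℕ)] (xr r), μ⟩‖ ^ 2 := by
    intro r
    have hfac : conjR (u r) ((((holT V (xr r) (List.replicate (P.L ^ k) (μ, true)) : (Matrix (Fin N) (Fin N) ℂ)ˣ) : Matrix (Fin N) (Fin N) ℂ) * (((holT V₀ (xr r) (List.replicate (P.L ^ k) (μ, true)))⁻¹ : (Matrix (Fin N) (Fin N) ℂ)ˣ) : Matrix (Fin N) (Fin N) ℂ) - 1)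
            - ∑ t : Fin (P.L ^ k), conjR (holT V₀ (xr r) (List.replicate (t : ℕ) (μ, true))) (Y ⟨(fun z : Site P 0 => z.shift μ)^[(t : ℕ)] (xr r), μ⟩))
        = conjR (u r) (((holT V (xr r) (List.replicate (P.L ^ k) (μ, true)) : (Matrix (Fin N) (Fin N) ℂ)ˣ) : Matrix (Fin N) (Fin N) ℂ) * (((holT V₀ (xr r) (List.replicate (P.L ^ k) (μ, true)))⁻¹ : (Matrix (Fin N) (Fin N) ℂ)ˣ) : Matrix (Fin N) (Fin N) ℂ) - 1)
          - ∑ t : Fin (P.L ^ k), conjR (u r * holT V₀ (xr r) (List.replicate (t : ℕ) (μ, true))) (Y ⟨(fun z : Site P 0 => z.shift μ)^[(t : ℕ)] (xr r), μ⟩) := by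
      rw [conjR_sub, conjR_sum]
      simp only [conjR_conjR]
    rw [← hfac, norm_conjR (hu r)]
    exact norm_lineRatio_sub_one_sub_sum_le hY hV₀ hYδ hnδ (xr r) μ
  have hsum := (norm_sum_le _ _).trans (Finset.sum_le_sum fun r (_ : r ∈ univ) => hpt r)
  rw [← Finset.mul_sum] at hsum
  have hpow : (((P.L : ℝ) ^ k) ^ P.d)⁻¹ * ((P.L : ℝ) ^ k) = (((P.L : ℝ) ^ k) ^ (P.d - 1))⁻¹ := by
    have : ((P.L : ℝ) ^ k) ^ P.d = ((P.L : ℝ) ^ k) ^ (P.d - 1) * (P.L : ℝ) ^ k := by rw [← pow_succ]; congr 1; omega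
    rw [this]; field_simp
  calc (((P.L : ℝ) ^ k) ^ P.d)⁻¹ * ‖∑ r : Fin P.d → Fin (P.L ^ k),
          (conjR (u r) (((holT V (xr r) (List.replicate (P.L ^ k) (μ, true)) : (Matrix (Fin N) (Fin N) ℂ)ˣ) : Matrix (Fin N) (Fin N) ℂ) * (((holT V₀ (xr r) (List.replicate (P.L ^ k) (μ, true)))⁻¹ : (Matrix (Fin N) (Fin N) ℂ)ˣ) : Matrix (Fin N) (Fin N) ℂ) - 1)
            - ∑ t : Fin (P.L ^ k), conjR (u r * holT V₀ (xr r) (List.replicate (t : ℕ) (μ, true))) (Y ⟨(fun z : Site P 0 => z.shift μ)^[(t : ℕ)] (xr r), μ⟩))‖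
      ≤ (((P.L : ℝ) ^ k) ^ P.d)⁻¹ * (((P.L ^ k : ℕ) : ℝ) * ∑ r : Fin P.d → Fin (P.L ^ k), ∑ t : Fin (P.L ^ k), ‖Y ⟨(fun z : Site P 0 => z.shift μ)^[(t : ℕ)] (xr r), μ⟩‖ ^ 2) :=
        mul_le_mul_of_nonneg_left hsum (by positivity)
    _ = _ := by push_cast; rw [← mul_assoc, hpow]

end Block

end Summit.QuantumFields.YangMills.Theorems.Prop7CovLineAvgTaylor

end
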